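import Summits.NavierStokesRegularity.TurbBounds.FSU1.CellSound

/-!
# FS-U1″ finite part in Lean — the corner inequality and the scalar side conditions (§6–§7)
(split by topic from `FSU1/Check.lean` at the gen-20 re-stage, LEAD decision 118 (A); same producer / staging / proof of record as `FSU1/Check.lean`.)

HONEST FRAMING: rigorous bounds for the stated PDE and boundary conditions; no claim about physical turbulence beyond the bound.

CONTENTS. §6 the corner inequality (A_corner) `CornerIneq` of FS-PROOF-DRAFT 3.9 (b), its rational criterion `cornerCheck` on a `CRow` of
witnesses and `cornerIneq_of_check`; §7 the scalar side conditions `ScalarLines` of FS-PROOF-DRAFT §3.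
-/

set_option linter.style.longLine false
set_option autoImplicit false

namespace Summit.NavierStokesRegularity.TurbBounds.FSU1

/-! ## 6. The corner inequality (A_corner) of FS-PROOF-DRAFT 3.9 (b) and its rational criterion -/

/-- `31.6227767 ≥ √1000`. -/
def R4HI : ℚ := 316227767 / 10000000

/-- `√1000 ≤ 31.6227767`. -/
theorem R4_le_R4HI : R4 ≤ ((R4HI : ℚ) : ℝ) := by
  unfold R4
  calc Real.sqrt 1000 ≤ Real.sqrt (((R4HI : ℚ) : ℝ) ^ 2) := Real.sqrt_le_sqrt (by norm_num [R4HI])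
    _ = ((R4HI : ℚ) : ℝ) := Real.sqrt_sq (by norm_num [R4HI])

/-- `k_c = κ_I·Ra₀^{1/4}` (the corner wavenumber). -/
noncomputable def kc (p : Params) : ℝ := (p.kapI : ℝ) * R4
/-- `F_edge = 1/(1 + 2e^{−k_c}k_c(m̃_I+1)²κ_I²/c + 4(m̃_I+1)κ_I²/(c·sinh k_c))`, `m̃_I = m̃(κ_I)` (FS-PROOF-DRAFT 3.9 (b)). -/
noncomputable def Fedge (p : Params) : ℝ :=
  1 / (1 + 2 * Real.exp (-kc p) * kc p * (mt p p.kapI + 1) ^ 2 * (p.kapI : ℝ) ^ 2 / p.c +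
    4 * (mt p p.kapI + 1) * (p.kapI : ℝ) ^ 2 / ((p.c : ℝ) * Real.sinh (kc p)))
/-- **(A_corner)** of FS-PROOF-DRAFT 3.9 (b) with Schur weight `ε`, including its regime of validity:
`r₁c²/(1−ε) + r₂c²/ε ≤ 1`, `r₁c² = γ²D³PH(ρ_I)/(F_edge·Φ(κ_I))`, `r₂c² = r̄₂²(κ_I, ρ_I)`. -/
def CornerIneq (p : Params) (eps : ℚ) : Prop :=
  0 < eps ∧ eps < 1 ∧ 0 < Fedge p ∧ 0 < Phi p p.kapI ∧
    (1 / 4 : ℝ) * (p.D : ℝ) ^ 3 * PH p.rhoI / (Fedge p * Phi p p.kapI) / (1 - eps) + r2sq p p.kapI p.rhoI / eps ≤ 1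

/-- Corner witnesses: `ε`, `sPhi ≤ √(κ_I²+c)`, `mI ≥ m̃_I`, `EK ≥ e^{−kcw}`, `SH ≤ sinh kcw` (`kcw = min(κ_I·R4LO, 20) ≤ k_c`). -/
structure CRow where
  eps : ℚ
  sPhi : ℚ
  mI : ℚ
  EK : ℚ
  SH : ℚ

/-- `κ_I·R4LO`, a rational lower bound of the corner wavenumber `k_c = κ_I·√1000`. -/
def kclo (p : Params) : ℚ := p.kapI * R4LO
/-- `κ_I·R4HI`, a rational upper bound of `k_c`. -/
def kchi (p : Params) : ℚ := p.kapI * R4HI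
/-- `min(κ_I·R4LO, PWCAP)`: capped lower bound of `k_c` at which the exponential witnesses are taken. -/
def kcw (p : Params) : ℚ := min (kclo p) PWCAP
/-- Rational upper bound of the corner correction `X` in `F_edge = 1/(1+X)` (witnesses `EK`, `SH`, `mI`) (soundness: `cornerIneq_of_check`). -/
def XW (p : Params) (w : CRow) : ℚ :=
  2 * w.EK * kchi p * (w.mI + 1) ^ 2 * p.kapI ^ 2 / p.c + 4 * (w.mI + 1) * p.kapI ^ 2 / (p.c * w.SH)
/-- Rational lower bound `1/(1+XW) ≤ F_edge` (soundness: `cornerIneq_of_check`). -/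
def FedgeW (p : Params) (w : CRow) : ℚ := 1 / (1 + XW p w)
/-- Rational lower bound of `Φ(κ_I)` from the witness `sPhi ≤ √(κ_I²+c)` (soundness: `cornerIneq_of_check`). -/
def phiI (p : Params) (w : CRow) : ℚ := 2 * p.a * (p.kapI + w.sPhi) ^ 2 / p.kapI
/-- Rational upper bound of the first ratio of the corner inequality (uses `FedgeW`, `phiI`, `PH(ρ_I)`) (soundness: `cornerIneq_of_check`). -/
def RC1 (p : Params) (w : CRow) : ℚ := 1 / 4 * p.D ^ 3 * evenPolyQ PHc p.rhoI / (FedgeW p w * phiI p w)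

/-- Corner sign and range conditions: `a, b′, D, κ_I > 0`, `0 < ε < 1`. -/
def cBasic (p : Params) (w : CRow) : Bool :=
  decide (0 < p.a) && decide (0 < p.bp) && decide (0 < p.D) && decide (0 < p.kapI) && decide (0 < w.eps) && decide (w.eps < 1)
/-- Conditions validating the corner witnesses `sPhi` (`0 ≤ sPhi`, `sPhi² ≤ κ_I²+c`) and `mI` (`1 ≤ mI`, `κ_I²+c ≤ mI²κ_I²`). -/
def cPhiM (p : Params) (w : CRow) : Bool :=
  decide (0 ≤ w.sPhi) && decide (w.sPhi ^ 2 ≤ p.kapI ^ 2 + p.c) && decide (0 < phiI p w) &&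
    decide (1 ≤ w.mI) && decide (p.kapI ^ 2 + p.c ≤ w.mI ^ 2 * p.kapI ^ 2)
/-- Corner exponential / hyperbolic enclosures through `expS` at `kcw`: `EK·expS ≥ 1`, `SH ≤ sinh` in polynomial form. -/
def cExp (p : Params) (w : CRow) : Bool :=
  decide (0 ≤ w.EK) && decide (1 ≤ w.EK * expS (kcw p)) && decide (0 < w.SH) && decide (1 ≤ expS (kcw p)) &&
    decide (2 * w.SH * expS (kcw p) + 1 ≤ expS (kcw p) ^ 2)
/-- Nonnegativity of the majorant values at `ρ_I` and the final corner inequality `RC1/(1−ε) + R2q/ε ≤ 1`. -/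
def cFin (p : Params) (w : CRow) : Bool :=
  decide (0 ≤ evenPolyQ PHc p.rhoI) && decide (0 ≤ evenPolyQ PJc p.rhoI) &&
    decide (RC1 p w / (1 - w.eps) + R2q p p.kapI p.rhoI / w.eps ≤ 1)
/-- The complete rational criterion for the corner. -/
def cornerCheck (p : Params) (w : CRow) : Bool := cBasic p w && cPhiM p w && cExp p w && cFin p w

/-- `m̃(κ) ≤ mI` from an upper square-root witness. -/
theorem mt_le_of_wit {p : Params} {κ mI : ℚ} (hκ : 0 < κ) (hm : 1 ≤ mI) (h : κ ^ 2 + p.c ≤ mI ^ 2 * κ ^ 2) :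
    mt p κ ≤ (mI : ℝ) := by
  unfold mt
  have hκR : (0 : ℝ) < (κ : ℝ) := by exact_mod_cast hκ
  have hmR : (0 : ℝ) ≤ (mI : ℝ) := by
    have : (0 : ℚ) ≤ mI := le_trans zero_le_one hm
    exact_mod_cast this
  have hk2 : (0 : ℝ) < (κ : ℝ) ^ 2 := by positivity
  have hle : (1 : ℝ) + (p.c : ℝ) / (κ : ℝ) ^ 2 ≤ (mI : ℝ) ^ 2 := by
    rw [show (1 : ℝ) + (p.c : ℝ) / (κ : ℝ) ^ 2 = ((κ : ℝ) ^ 2 + p.c) / (κ : ℝ) ^ 2 by field_simp]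
    rw [div_le_iff₀ hk2]
    exact_mod_cast h
  calc Real.sqrt (1 + (p.c : ℝ) / (κ : ℝ) ^ 2) ≤ Real.sqrt ((mI : ℝ) ^ 2) := Real.sqrt_le_sqrt hle
    _ = (mI : ℝ) := Real.sqrt_sq hmR

/-- The rational corner criterion implies (A_corner) over `ℝ`. -/
theorem cornerIneq_of_check (p : Params) (w : CRow) (h : cornerCheck p w = true) : CornerIneq p w.eps := by
  have hb : cBasic p w = true := by simp only [cornerCheck, Bool.and_eq_true] at h; exact h.1.1.1
  have hpm : cPhiM p w = true := by simp only [cornerCheck, Bool.and_eq_true] at h; exact h.1.1.2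
  have hex : cExp p w = true := by simp only [cornerCheck, Bool.and_eq_true] at h; exact h.1.2
  have hfin : cFin p w = true := by simp only [cornerCheck, Bool.and_eq_true] at h; exact h.2
  simp only [cBasic, Bool.and_eq_true, decide_eq_true_eq] at hb
  obtain ⟨⟨⟨⟨⟨ha, hbp⟩, hD⟩, hkI⟩, heps0⟩, heps1⟩ := hb
  simp only [cPhiM, Bool.and_eq_true, decide_eq_true_eq] at hpm
  obtain ⟨⟨⟨⟨hs0, hs2⟩, hphiI⟩, hm1⟩, hm2⟩ := hpm
  simp only [cExp, Bool.and_eq_true, decide_eq_true_eq] at hex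
  obtain ⟨⟨⟨⟨hEK0, hEK⟩, hSH0⟩, hS1⟩, hSH⟩ := hex
  simp only [cFin, Bool.and_eq_true, decide_eq_true_eq] at hfin
  obtain ⟨⟨hPH0, hPJ0⟩, hfinal⟩ := hfin
  have haR : (0 : ℝ) < (p.a : ℝ) := by exact_mod_cast ha
  have hcQ : 0 < p.c := by unfold Params.c; exact div_pos hbp ha
  have hcR : (0 : ℝ) < (p.c : ℝ) := by exact_mod_cast hcQ
  have hkIR : (0 : ℝ) < (p.kapI : ℝ) := by exact_mod_cast hkI
  have hDR : (0 : ℝ) < (p.D : ℝ) := by exact_mod_cast hD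
  -- Φ(κ_I) ≥ phiI > 0
  have hPhi : ((phiI p w : ℚ) : ℝ) ≤ Phi p p.kapI := by
    unfold phiI; push_cast; exact Phi_ge haR.le hkIR (by exact_mod_cast hs0) (by exact_mod_cast hs2)
  have hphiIR : (0 : ℝ) < ((phiI p w : ℚ) : ℝ) := by exact_mod_cast hphiI
  have hPhipos : 0 < Phi p p.kapI := lt_of_lt_of_le hphiIR hPhi
  -- m̃_I ≤ mI
  have hM : mt p p.kapI ≤ (w.mI : ℝ) := mt_le_of_wit hkI hm1 hm2
  have hM0 : 0 ≤ mt p p.kapI := Real.sqrt_nonneg _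
  -- k_c between its rational bounds
  have hkc_lo : ((kcw p : ℚ) : ℝ) ≤ kc p := by
    unfold kcw kclo kc; push_cast
    refine le_trans (min_le_left _ _) ?_
    exact mul_le_mul_of_nonneg_left R4LO_le_R4 hkIR.le
  have hkc_hi : kc p ≤ ((kchi p : ℚ) : ℝ) := by
    unfold kchi kc; push_cast; exact mul_le_mul_of_nonneg_left R4_le_R4HI hkIR.le
  have hkcw0 : 0 ≤ kcw p := by
    unfold kcw kclo
    refine le_min ?_ (by norm_num [PWCAP])
    have : 0 ≤ R4LO := by norm_num [R4LO]
    have : 0 ≤ p.kapI := hkI.le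
    positivity
  have hkc0 : 0 ≤ kc p := by unfold kc R4; positivity
  have hexp : Real.exp (-kc p) ≤ (w.EK : ℝ) := exp_neg_le_of_wit hkcw0 hkc_lo hEK0 hEK
  have hsinh : ((w.SH : ℚ) : ℝ) ≤ Real.sinh (kc p) := sinh_ge_of_wit hkcw0 hkc_lo hS1 hSH
  have hSHR : (0 : ℝ) < (w.SH : ℝ) := by exact_mod_cast hSH0
  have hsinhpos : 0 < Real.sinh (kc p) := lt_of_lt_of_le hSHR hsinh
  have hEKR : (0 : ℝ) ≤ (w.EK : ℝ) := by exact_mod_cast hEK0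
  have hmIR : (1 : ℝ) ≤ (w.mI : ℝ) := by exact_mod_cast hm1
  have hkchi0 : (0 : ℝ) ≤ ((kchi p : ℚ) : ℝ) := le_trans hkc0 hkc_hi
  -- the denominator excess X ≤ XW
  set M : ℝ := mt p p.kapI with hMdef
  have hX_le : 2 * Real.exp (-kc p) * kc p * (M + 1) ^ 2 * (p.kapI : ℝ) ^ 2 / p.c +
      4 * (M + 1) * (p.kapI : ℝ) ^ 2 / ((p.c : ℝ) * Real.sinh (kc p)) ≤ ((XW p w : ℚ) : ℝ) := by
    unfold XW; push_cast
    have t1 : 2 * Real.exp (-kc p) * kc p * (M + 1) ^ 2 * (p.kapI : ℝ) ^ 2 / p.c ≤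
        2 * (w.EK : ℝ) * ((kchi p : ℚ) : ℝ) * ((w.mI : ℝ) + 1) ^ 2 * (p.kapI : ℝ) ^ 2 / p.c := by
      apply div_le_div_of_nonneg_right _ hcR.le
      have e1 : 2 * Real.exp (-kc p) * kc p ≤ 2 * (w.EK : ℝ) * ((kchi p : ℚ) : ℝ) := by
        have := mul_le_mul hexp hkc_hi hkc0 hEKR
        linarith
      have e2 : (M + 1) ^ 2 ≤ ((w.mI : ℝ) + 1) ^ 2 := by nlinarith
      have e3 : (0 : ℝ) ≤ 2 * Real.exp (-kc p) * kc p := by positivity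
      have e4 := mul_le_mul e1 e2 (by positivity) (by positivity)
      exact mul_le_mul_of_nonneg_right e4 (by positivity)
    have t2 : 4 * (M + 1) * (p.kapI : ℝ) ^ 2 / ((p.c : ℝ) * Real.sinh (kc p)) ≤
        4 * ((w.mI : ℝ) + 1) * (p.kapI : ℝ) ^ 2 / ((p.c : ℝ) * (w.SH : ℝ)) := by
      have n1 : 4 * (M + 1) * (p.kapI : ℝ) ^ 2 ≤ 4 * ((w.mI : ℝ) + 1) * (p.kapI : ℝ) ^ 2 := by
        nlinarith [sq_nonneg (p.kapI : ℝ)]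
      have d1 : (p.c : ℝ) * (w.SH : ℝ) ≤ (p.c : ℝ) * Real.sinh (kc p) := mul_le_mul_of_nonneg_left hsinh hcR.le
      calc 4 * (M + 1) * (p.kapI : ℝ) ^ 2 / ((p.c : ℝ) * Real.sinh (kc p))
          ≤ 4 * ((w.mI : ℝ) + 1) * (p.kapI : ℝ) ^ 2 / ((p.c : ℝ) * Real.sinh (kc p)) :=
            div_le_div_of_nonneg_right n1 (by positivity)
        _ ≤ 4 * ((w.mI : ℝ) + 1) * (p.kapI : ℝ) ^ 2 / ((p.c : ℝ) * (w.SH : ℝ)) :=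
            div_le_div_of_nonneg_left (by positivity) (by positivity) d1
    linarith
  have hX0 : 0 ≤ 2 * Real.exp (-kc p) * kc p * (M + 1) ^ 2 * (p.kapI : ℝ) ^ 2 / p.c +
      4 * (M + 1) * (p.kapI : ℝ) ^ 2 / ((p.c : ℝ) * Real.sinh (kc p)) := by positivity
  have hFW_cast : ((FedgeW p w : ℚ) : ℝ) = 1 / (1 + ((XW p w : ℚ) : ℝ)) := by unfold FedgeW; push_cast; ring
  have hF : ((FedgeW p w : ℚ) : ℝ) ≤ Fedge p := by
    rw [hFW_cast]; unfold Fedge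
    exact one_div_le_one_div_of_le (by linarith) (by linarith)
  have hFWpos : (0 : ℝ) < ((FedgeW p w : ℚ) : ℝ) := by
    rw [hFW_cast]
    have : (0 : ℝ) ≤ ((XW p w : ℚ) : ℝ) := le_trans hX0 hX_le
    positivity
  have hFpos : 0 < Fedge p := lt_of_lt_of_le hFWpos hF
  -- r₁c² ≤ RC1, r₂c² ≤ R2q
  have hR1 : (1 / 4 : ℝ) * (p.D : ℝ) ^ 3 * PH p.rhoI / (Fedge p * Phi p p.kapI) ≤ ((RC1 p w : ℚ) : ℝ) := by
    unfold RC1 PH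
    rw [evenPoly_cast]
    push_cast
    have hN : (0 : ℝ) ≤ 1 / 4 * (p.D : ℝ) ^ 3 * ((evenPolyQ PHc p.rhoI : ℚ) : ℝ) := by
      have : (0 : ℝ) ≤ ((evenPolyQ PHc p.rhoI : ℚ) : ℝ) := by exact_mod_cast hPH0
      positivity
    exact div_le_div_of_nonneg_left hN (mul_pos hFWpos hphiIR) (mul_le_mul hF hPhi hphiIR.le hFpos.le)
  have hR2 := r2sq_le_R2q p p.kapI p.rhoI ha hbp hD hPJ0
  have heps0R : (0 : ℝ) < (w.eps : ℝ) := by exact_mod_cast heps0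
  have heps1R : (w.eps : ℝ) < 1 := by exact_mod_cast heps1
  have hfinR : ((RC1 p w : ℚ) : ℝ) / (1 - (w.eps : ℝ)) + ((R2q p p.kapI p.rhoI : ℚ) : ℝ) / (w.eps : ℝ) ≤ 1 := by
    have h' : (((RC1 p w / (1 - w.eps) + R2q p p.kapI p.rhoI / w.eps : ℚ)) : ℝ) ≤ 1 := by exact_mod_cast hfinal
    push_cast at h'
    exact h'
  refine ⟨heps0, heps1, hFpos, hPhipos, ?_⟩
  calc (1 / 4 : ℝ) * (p.D : ℝ) ^ 3 * PH p.rhoI / (Fedge p * Phi p p.kapI) / (1 - (w.eps : ℝ)) + r2sq p p.kapI p.rhoI / (w.eps : ℝ)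
      ≤ ((RC1 p w : ℚ) : ℝ) / (1 - (w.eps : ℝ)) + ((R2q p p.kapI p.rhoI : ℚ) : ℝ) / (w.eps : ℝ) :=
        add_le_add (div_le_div_of_nonneg_right hR1 (by linarith)) (div_le_div_of_nonneg_right hR2 heps0R.le)
    _ ≤ 1 := hfinR

/-! ## 7. The scalar side conditions of FS-PROOF-DRAFT §3 -/

/-- The scalar lines of the chain (FS-PROOF-DRAFT 3.0–3.3, 3.9 (b)(c)): admissible Young/balance weights (`a > 0`, `0 < b < 1`, `b′ > 0`,
`u_I ∈ [a²/(4b), 1]` i.e. `b_I ≥ 0`), disjoint layers at `Ra₀` (`(2D)¹² ≤ Ra₀⁵`), `0 < ρ_I ≤ 1` (validity range of the majorants `PH`, `PJ`),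
the regime-I inequality (I₀) `γ²D⁴Ra₀^{−1/6}/a ≤ ρ_I²(π²/4 + (1−u_I)ρ_I²)(π²/2 + ρ_I²)`, and the three edge side conditions
`κ*² ≤ κ_I²`, `b′ ≤ aκ_I²(1 + π²/(4ρ_I²))`, `k_c = κ_I·Ra₀^{1/4} ≥ 3`. -/
def ScalarLines (p : Params) : Prop :=
  0 < p.a ∧ 0 < p.b ∧ p.b < 1 ∧ p.a ^ 2 < 4 * p.b ∧ p.a ^ 2 / (4 * p.b) ≤ p.uI ∧ p.uI ≤ 1 ∧ 0 < p.D ∧ (2 * p.D) ^ 12 ≤ 10 ^ 30 ∧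
    0 < p.rhoI ∧ p.rhoI ≤ 1 ∧ p.kstar2 ≤ p.kapI ^ 2 ∧
    (1 / 4 : ℝ) * (p.D : ℝ) ^ 4 / 10 / p.a ≤
      (p.rhoI : ℝ) ^ 2 * (Real.pi ^ 2 / 4 + (1 - p.uI) * (p.rhoI : ℝ) ^ 2) * (Real.pi ^ 2 / 2 + (p.rhoI : ℝ) ^ 2) ∧
    (p.bp : ℝ) ≤ p.a * (p.kapI : ℝ) ^ 2 * (1 + Real.pi ^ 2 / (4 * (p.rhoI : ℝ) ^ 2)) ∧
    3 ≤ (p.kapI : ℝ) * R4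

end Summit.NavierStokesRegularity.TurbBounds.FSU1
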